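import Summits.NavierStokesRegularity.FluidComputer.GalerkinSmooth
import Summits.NavierStokesRegularity.FluidComputer.TimeParity
import Mathlib.Analysis.Calculus.Taylor
import HarnessLib

/-!
# The enstrophy of a Galerkin run as a Taylor polynomial plus an honest Lagrange remainder

HONEST FRAMING: typed infrastructure for a low prior, high value-of-information experiment on
Tao's machine paradigm; NOT a claim that NS blows up.

The classical short-time analyses of the inviscid Taylor–Green / Kida–Pelz / Ohkitani-family runs
work with the Taylor series of the enstrophy in powers of `t²`
[cite: Ohkitani2001ODEEnstrophy, §3.1 eq. (24), App. (A1)]; the cell's exact-series tools compute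
its coefficients through a finite order.  What such a truncated series says about `Z(t)` itself is
Taylor's theorem with remainder, which needs the derivatives to exist: `GalerkinSmooth` (this tree)
proves Galerkin runs are `C^∞` in time, so Mathlib's `taylor_mean_remainder_lagrange_iteratedDeriv`
applies.  This file records the resulting statements:

* `taylor_lagrange_of_contDiff`: for a `C^∞` function `f : ℝ → ℝ` and `t > 0`,
  `f(t) = Σ_{k ≤ n} f⁽ᵏ⁾(0) tᵏ/k! + f⁽ⁿ⁺¹⁾(ξ) tⁿ⁺¹/(n+1)!` for some `ξ ∈ (0, t)` (the within-set
  Taylor coefficients of Mathlib's `taylorWithinEval` are identified with plain iterated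
  derivatives);
* `truncEnstrophy_taylor`: the same for `t ↦ Z_T(û(t))` along any unforced Galerkin run supported in
  `S` (any `ν`, any mode set `T`);
* `truncEnstrophy_taylor_even`: for an inviscid run whose datum is reversed by a translation
  (`TimeParity.translate_eq_reverse`; Taylor–Green, Kida–Pelz, every Ohkitani member) the odd
  coefficients vanish and `Z_T(t) = Σ_{m ≤ M} Z_T⁽²ᵐ⁾(0) t²ᵐ/(2m)! + Z_T⁽²ᴹ⁺²⁾(ξ) t²ᴹ⁺²/(2M+2)!`;
  `fam_truncEnstrophy_taylor_even` is the instance for the family `(A, B, -(A+B))`.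

0 sorry, 0 named facts.
-/

noncomputable section

namespace Summit.NavierStokesRegularity.FluidComputer.EnstrophyTaylor

open Set
open Literature.Analysis.FluidPDE.FluidComputer
open Literature.Analysis.FluidPDE.FluidComputer.ShellTransfer
open Literature.Analysis.FluidPDE.FluidComputer.ShellTransfer.TaylorGreenHat
open scoped BigOperators Nat ContDiff

/-! ## Taylor's theorem with Lagrange remainder for a globally smooth real function -/

/-- For a globally `C^∞` function the within-`[a, b]` Taylor polynomial at `a` has the plain
iterated derivatives as coefficients. [folklore] -/
theorem taylorWithinEval_eq_sum {f : ℝ → ℝ} (hf : ContDiff ℝ ∞ f) {a b : ℝ} (hab : a < b)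
    (n : ℕ) :
    taylorWithinEval f n (uIcc a b) a b
      = ∑ k ∈ Finset.range (n + 1), iteratedDeriv k f a * (b - a) ^ k / k ! := by
  rw [taylor_within_apply]
  refine Finset.sum_congr rfl fun k _ => ?_
  rw [uIcc_of_le hab.le, iteratedDerivWithin_eq_iteratedDeriv (uniqueDiffOn_Icc hab)
    (contDiff_infty.1 hf k).contDiffAt (left_mem_Icc.2 hab.le), smul_eq_mul]
  ring

/-- **Taylor–Lagrange at `0` for a `C^∞` function**: `f(t) = Σ_{k ≤ n} f⁽ᵏ⁾(0) tᵏ/k! +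
f⁽ⁿ⁺¹⁾(ξ) tⁿ⁺¹/(n+1)!` for some `ξ ∈ (0, t)`. [folklore] -/
theorem taylor_lagrange_of_contDiff {f : ℝ → ℝ} (hf : ContDiff ℝ ∞ f) {t : ℝ} (ht : 0 < t)
    (n : ℕ) :
    ∃ ξ ∈ Ioo 0 t, f t = (∑ k ∈ Finset.range (n + 1), iteratedDeriv k f 0 * t ^ k / k !)
      + iteratedDeriv (n + 1) f ξ * t ^ (n + 1) / (n + 1)! := by
  have hcd : ContDiffOn ℝ (n + 1) f (uIcc 0 t) := by
    have h := (contDiff_infty.1 hf (n + 1)).contDiffOn (s := uIcc 0 t)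
    rw [Nat.cast_succ] at h
    exact h
  obtain ⟨ξ, hξ, e⟩ := taylor_mean_remainder_lagrange_iteratedDeriv (ne_of_lt ht) hcd
  refine ⟨ξ, by simpa [uIoo_of_le ht.le] using hξ, ?_⟩
  rw [taylorWithinEval_eq_sum hf ht n] at e
  simp only [sub_zero] at e
  linarith

/-- Summing over `k < 2M` a sequence whose odd terms vanish is summing its even terms.
[folklore] -/
theorem sum_range_even_of_odd_zero (a : ℕ → ℝ) (h : ∀ m, a (2 * m + 1) = 0) :
    ∀ M : ℕ, ∑ k ∈ Finset.range (2 * M), a k = ∑ m ∈ Finset.range M, a (2 * m)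
  | 0 => by simp
  | M + 1 => by
    rw [show 2 * (M + 1) = 2 * M + 1 + 1 by ring, Finset.sum_range_succ, Finset.sum_range_succ,
      sum_range_even_of_odd_zero a h M, h M, Finset.sum_range_succ]
    ring

/-- **Even Taylor–Lagrange**: if the odd derivatives of a `C^∞` function vanish at `0` then
`f(t) = Σ_{m ≤ M} f⁽²ᵐ⁾(0) t²ᵐ/(2m)! + f⁽²ᴹ⁺²⁾(ξ) t²ᴹ⁺²/(2M+2)!` for some `ξ ∈ (0, t)`.
[folklore] -/
theorem taylor_lagrange_even {f : ℝ → ℝ} (hf : ContDiff ℝ ∞ f)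
    (hodd : ∀ m : ℕ, iteratedDeriv (2 * m + 1) f 0 = 0) {t : ℝ} (ht : 0 < t) (M : ℕ) :
    ∃ ξ ∈ Ioo 0 t, f t
      = (∑ m ∈ Finset.range (M + 1), iteratedDeriv (2 * m) f 0 * t ^ (2 * m) / (2 * m)!)
        + iteratedDeriv (2 * M + 2) f ξ * t ^ (2 * M + 2) / (2 * M + 2)! := by
  obtain ⟨ξ, hξ, e⟩ := taylor_lagrange_of_contDiff hf ht (2 * M + 1)
  refine ⟨ξ, hξ, ?_⟩
  have hsum := sum_range_even_of_odd_zero (fun k => iteratedDeriv k f 0 * t ^ k / k !)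
    (fun m => by simp only [hodd m, zero_mul, zero_div]) (M + 1)
  rw [show 2 * (M + 1) = 2 * M + 1 + 1 by ring] at hsum
  rw [hsum, show 2 * M + 1 + 1 = 2 * M + 2 by ring] at e
  exact e

/-! ## Along Galerkin runs -/

variable {U : ℝ → FourierVelocity} {S : Finset (Fin 3 → ℤ)} {ν : ℝ} {c : ℝ → (Fin 3 → ℤ) → ℂ}
  {a : Fin 3 → ℝ}

/-- **The enstrophy of an unforced Galerkin run (any `ν`, any mode set `T`) is its Taylor polynomial
at `t = 0` plus a Lagrange remainder**:
`Z_T(t) = Σ_{k ≤ n} Z_T⁽ᵏ⁾(0) tᵏ/k! + Z_T⁽ⁿ⁺¹⁾(ξ) tⁿ⁺¹/(n+1)!` for some `ξ ∈ (0, t)`. [folklore] -/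
theorem truncEnstrophy_taylor (hU : IsGalerkinSolution U S ν c fun _ _ _ => 0)
    (hs : IsSupportedOn U S) (T : Finset (Fin 3 → ℤ)) {t : ℝ} (ht : 0 < t) (n : ℕ) :
    ∃ ξ ∈ Ioo 0 t, truncEnstrophy (U t) T
      = (∑ k ∈ Finset.range (n + 1),
          iteratedDeriv k (fun s => truncEnstrophy (U s) T) 0 * t ^ k / k !)
        + iteratedDeriv (n + 1) (fun s => truncEnstrophy (U s) T) ξ * t ^ (n + 1) / (n + 1)! :=
  taylor_lagrange_of_contDiff (GalerkinSmooth.contDiff_truncEnstrophy_unforced hU hs T) ht n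

/-- **Inviscid runs with a translation-reversed datum: the series is in `t²` with an honest
remainder** — `Z_T(t) = Σ_{m ≤ M} Z_T⁽²ᵐ⁾(0) t²ᵐ/(2m)! + Z_T⁽²ᴹ⁺²⁾(ξ) t²ᴹ⁺²/(2M+2)!` for some
`ξ ∈ (0, t)`. [cite: Ohkitani2001ODEEnstrophy, §3.1 eq. (24) (series in ξ = t²)] -/
theorem truncEnstrophy_taylor_even (hU : IsGalerkinSolution U S 0 c fun _ _ _ => 0)
    (hs : IsSupportedOn U S) (h0 : translate a (U 0) = scale (-1) (U 0))
    (T : Finset (Fin 3 → ℤ)) {t : ℝ} (ht : 0 < t) (M : ℕ) :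
    ∃ ξ ∈ Ioo 0 t, truncEnstrophy (U t) T
      = (∑ m ∈ Finset.range (M + 1),
          iteratedDeriv (2 * m) (fun s => truncEnstrophy (U s) T) 0 * t ^ (2 * m) / (2 * m)!)
        + iteratedDeriv (2 * M + 2) (fun s => truncEnstrophy (U s) T) ξ * t ^ (2 * M + 2)
          / (2 * M + 2)! :=
  taylor_lagrange_even (GalerkinSmooth.contDiff_truncEnstrophy_unforced hU hs T)
    (fun m => TimeParity.iteratedDeriv_truncEnstrophy_odd hU hs h0 T (odd_two_mul_add_one m)) ht M

/-- **The Ohkitani family `(A, B, -(A+B))`** (Taylor–Green is the member `B = -A` up to sign and a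
translation): along every inviscid Galerkin run from `fam A B` supported in `S`,
`Z_T(t) = Σ_{m ≤ M} Z_T⁽²ᵐ⁾(0) t²ᵐ/(2m)! + Z_T⁽²ᴹ⁺²⁾(ξ) t²ᴹ⁺²/(2M+2)!` for some `ξ ∈ (0, t)`.
[cite: Ohkitani2001ODEEnstrophy, App. (A1)] -/
theorem fam_truncEnstrophy_taylor_even {A B : ℝ} (hU : IsGalerkinSolution U S 0 c fun _ _ _ => 0)
    (hs : IsSupportedOn U S) (h0 : U 0 = TaylorGreenFamily.fam A B) (T : Finset (Fin 3 → ℤ))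
    {t : ℝ} (ht : 0 < t) (M : ℕ) :
    ∃ ξ ∈ Ioo 0 t, truncEnstrophy (U t) T
      = (∑ m ∈ Finset.range (M + 1),
          iteratedDeriv (2 * m) (fun s => truncEnstrophy (U s) T) 0 * t ^ (2 * m) / (2 * m)!)
        + iteratedDeriv (2 * M + 2) (fun s => truncEnstrophy (U s) T) ξ * t ^ (2 * M + 2)
          / (2 * M + 2)! :=
  truncEnstrophy_taylor_even hU hs (by rw [h0, TimeParity.translate_halfX_fam]) T ht M

/-- The Taylor–Green datum. [cite: Ohkitani2001ODEEnstrophy, §3.1 eq. (24)] -/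
theorem tg_truncEnstrophy_taylor_even (hU : IsGalerkinSolution U S 0 c fun _ _ _ => 0)
    (hs : IsSupportedOn U S) (h0 : U 0 = tg) (T : Finset (Fin 3 → ℤ)) {t : ℝ} (ht : 0 < t)
    (M : ℕ) :
    ∃ ξ ∈ Ioo 0 t, truncEnstrophy (U t) T
      = (∑ m ∈ Finset.range (M + 1),
          iteratedDeriv (2 * m) (fun s => truncEnstrophy (U s) T) 0 * t ^ (2 * m) / (2 * m)!)
        + iteratedDeriv (2 * M + 2) (fun s => truncEnstrophy (U s) T) ξ * t ^ (2 * M + 2)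
          / (2 * M + 2)! :=
  truncEnstrophy_taylor_even hU hs (by rw [h0, translate_halfX_tg]) T ht M

/-- The Kida–Pelz datum. [folklore] -/
theorem kp_truncEnstrophy_taylor_even (hU : IsGalerkinSolution U S 0 c fun _ _ _ => 0)
    (hs : IsSupportedOn U S) (h0 : U 0 = KidaPelzHat.kp) (T : Finset (Fin 3 → ℤ)) {t : ℝ}
    (ht : 0 < t) (M : ℕ) :
    ∃ ξ ∈ Ioo 0 t, truncEnstrophy (U t) T
      = (∑ m ∈ Finset.range (M + 1),
          iteratedDeriv (2 * m) (fun s => truncEnstrophy (U s) T) 0 * t ^ (2 * m) / (2 * m)!)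
        + iteratedDeriv (2 * M + 2) (fun s => truncEnstrophy (U s) T) ξ * t ^ (2 * M + 2)
          / (2 * M + 2)! :=
  truncEnstrophy_taylor_even hU hs (by rw [h0, translate_halfX_kp]) T ht M

end Summit.NavierStokesRegularity.FluidComputer.EnstrophyTaylor

end
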